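import Summits.QuantumFields.BalabanUV.T4Continuum.Support.TermwiseHeterogeneousWindow

/-!
# TermwiseLevels — the LEVEL-GRADED (L) bound at one cutoff and the WINDOW CLAUSE turned into level shares: the two
pieces the term-wise chain still lacked to thread position-dependent one-step radii into the ledger

Cell `pub-balaban`, rung (B)+1 sub-cell t4, lineage `b2b-balaban-t4-ne7-p1` (node U5 = spine estimate NE7, TERM-WISE
member — technique «bound `δ_K` from the one-step rates composed along the tower; summability from the geometric
factors»; generation 17), record `t4/T4-EST-NE7-P1.md` §21 (21a).  HONEST FRAMING (page 1): pure YM₄ on a FIXED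
FINITE torus T⁴; the target of the sub-cell is the `ε → 0` limit of unit-scale averaged expectations of
gauge-invariant observables, CONDITIONAL on BetaPertH and the nine spine estimates (0/9 proved); NOT infinite volume,
NOT a mass gap, NOT the Clay problem.  NE7 is NOT PRINTED in [Balaban1984PropagatorsI]–[Balaban1989LargeFieldII] and
NOT proved here.  Everything below is [folklore] finite-sum bookkeeping over generation 10's one-step model
(`T4TermwiseQuartic`: a non-negative averaging kernel `w` with row sums `L²` and column sums `L⁻²`, an isometric
transport `Φ`, a plaquette weight `e` with the quartic sandwich) and generation 16's `TermwiseHeterogeneous(Window)`;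
no sentence of print is used as a fact; nothing printed is asserted.

THE POINT (record (20l)(γ)(i), the lineage's dated kernel step).  Generation 16 proved the one-step interpolation
error (U) with LEVEL-GRADED radii (`interpolationError_le_levels`: windows of regularity level `j ≤ K` carry
generation 10's radii AT SCALE `L^{−j}`; the error is `≤ vol·n₀·C_U·Σ_{j≤K} μ_j·(L⁻²)^j` with `μ_j` the level shares)
and the WINDOWED CENSUS (`summable_of_levels_logWindow`: shares vanishing below the cell's logarithmic cut
`jlogOf Cl K` and `≤ Λ^{K−j}` on the window give a summable majorant for every `θ < 1`).  Two things were left before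
the level-graded sandwich could FEED the ledger: (a) the (L) half — the averaging error at run B's minimiser — in the
same level-graded form; (b) the passage from a DISPLAYED window clause on a good term's level map to the level shares
the census consumes.  This module supplies both; the companion `Support/TermwiseLevelsLedger` then produces generation
9's six binders (U) `hUdev hdU0 hdU` (L) `hLdev hdL0 hdL` from level-graded radii under the window clause and calls
generation 9's ledger theorem ONCE.

WHAT IS PROVED ([folklore]).
§7 `levelShareL_le` — ONE level of (L) rescaled: generation 10's `averagingSize_le_scale` at `a = L^{−j}`,
   `b = L^{−(j+1)}`, counts in units of the level-`j` lattices (ONE CALL); `averagingError_le_levels` — THE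
   HETEROGENEOUS (L) BOUND AT ONE CUTOFF: windows graded by `lvl`, fine plaquettes by `lvlf` (the quartic weight
   remainder `q·Σ_x ‖φ x‖⁴` lives on the fine lattice and needs its own grading), level-`j` radii `sz_j ≤
   c₁ε₁L^{−2(j+1)}`, `ρb_j ≤ c₃ε₁²L^{−4j}`, at most `Nc_j` windows / `Nf_j` fine plaquettes of level `j` with
   `Nc_j·L^{−4j}, Nf_j·L^{−4(j+1)} ≤ n₀·vol·μ_j` ⇒ `Σ_y e(ψ y) − Σ_x e(φ x) ≤ vol·n₀·C_L·Σ_{j≤K} μ_j·(L⁻²)^j`,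
   `C_L = c₁c₃ε₁³ + c₃²ε₁⁴/2 + q·c₁⁴ε₁⁴` (generation 10's (L) constant; generation 16's §1 `averagingError_le_of_profiles`
   + §2 `sum_le_sum_levels` twice + §7's one-level lemma per level).
§8 THE WINDOW CLAUSE ⇒ LEVEL SHARES.  The clause is DISPLAYED in the tree's own vocabulary, `RecentOnly P′ lvl
   (jlogOf Cl K) K` (`T4GoodClassBudget`: every level lies in `[jlogOf Cl K, K]` — the form in which the boundary
   kind's (B-win) `hBwin` already enters the ledger).  `card_filter_level_eq_zero`: no window below the cut;
   `levelCount_coarse_le` / `levelCount_fine_le`: with the plaquette counts `#P′ ≤ n₀·vol·L^{4K}`,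
   `#P ≤ n₀·vol·L^{4(K+1)}` ALONE, the level-`j` share is `≤ n₀·vol·Λ^{K−j}` on the window (`Λ = L⁴`: «every
   plaquette might be of level `j`» — a volume FRACTION `≤ 1`, NO density statement) and `0` below it;
   `sum_shares_le_windowSum`: the resulting level sum is the tree's `windowSum L⁻² L⁴ (jlogOf Cl K) K`;
   `rate_facts`: `θ = L⁻² ∈ (0,1)`, `Λ = L⁴ ≥ 1`.
§9 `recentOnly_top`: the ALL-TOP-LEVEL map (the King-type / all-small-field history of generations 10–16) satisfies
   the clause for every cut constant — the uniform case is an instance, not a separate theorem;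
   `windowedMajorant_le_poly`: the windowed majorant is `poly(K)·(L⁻²)^K` (the tree's `windowSum_log_le`, displayed);
   two numerical instances (`K = 1`, `L = 2`): cut at the top gives `1/4`, window opened to age 1 gives `16 + 1/4`.

BINDER STATUS (which hypotheses are estimates).  (win) the window clause is the cell's crossover INTERFACE I-3 (T4-DAG
node U5c: a GOOD history carries pending structure only at levels `≥ jlogOf`; older structure is healed — top-level
regular again — or the history is in `Bad K t`, whose measure is the weight half NE7b): a DEFINITION of the hybrid's
classes, NOT PRINTED, not an estimate; what it costs is paid on the weight side.  (sz)(bch) per level: the SHAPES are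
those of [Balaban1985Variational] conditions (2) p. 278 «|U(∂p) − 1| < ε₀(L^jη)^{−2}η² … for p ∈ Ω_j» (level-`j`
regularity on the level-`j` domain of ONE run's sequence `{Ω_j}`; the same currency for the multi-domain backgrounds
of the large-field papers, [Balaban1989LargeFieldII] p. 361 «U_{k,Z} satisfies the usual regularity conditions (2)
[15], for the sequence {Ω′_j}») and of [Balaban1985Averaging] Prop. 1 (51) (the second-order term of the one-step
average) — LOCATED in shape, NOT PRINTED as these inequalities for both runs' backgrounds: ESTIMATES, exactly as in
generation 10's census, now indexed by level.  (scal) the size laws per level: generation 10's laws with `K ↦ j`.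
(ker)(tr)(wt)(cnt): generation 10's, verbatim.

NOT DELIVERED / NOT CLAIMED: the level maps of Bałaban's histories (which window has which level is U5a/U5c's datum,
carver); the U(N)-concrete producers of generations 11–13 ((bch) from the tree's (38)-remainder, (44), (44∇) from
`LocReg`/`HolderReg`) in level-graded form — their inputs are per-level `HolderReg` binders on young windows, the
lineage's NEXT step; any lower bound; anything about which histories are good.  Value = the (L) half and the
window-clause plumbing of the level-graded sandwich, kernel-checked; NOT NE7, NOT summit progress.

References (LOCATIONS only): [Balaban1985Variational] T. Bałaban, The variational problem and background fields in
renormalization group method for lattice gauge theories, Commun. Math. Phys. 102 (1985) 277–309, conditions (2)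
p. 278; [Balaban1985Averaging] T. Bałaban, Averaging operations for lattice gauge theories, Commun. Math. Phys. 98
(1985) 17–51, Prop. 1 (51) p. 26; [Balaban1989LargeFieldII] T. Bałaban, Large field renormalization. II.
Localization, exponentiation, and bounds for the R operation, Commun. Math. Phys. 122 (1989) 355–392, p. 361.
-/

noncomputable section

open Finset _root_.Filter _root_.Topology
open scoped BigOperators

namespace Summit.QuantumFields.BalabanUV.T4Continuum.TermwiseLevels

open Literature.MathematicalPhysics.QuantumFieldTheory.Balaban1983to89
open T4TermwiseQuartic TermwiseHeterogeneous
open T4GoodClassBudget (windowSum jlogOf summable_windowSum_log RecentOnly windowSum_nonneg jlogOf_le)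

/-! ## §7 The heterogeneous (L) bound at one cutoff (companion of `interpolationError_le_levels`) -/

section HeterogeneousL

variable {V : Type*} [NormedAddCommGroup V] [InnerProductSpace ℝ V] {X Y : Type*}

/-- **ONE LEVEL OF (L), RESCALED** — generation 10's `averagingSize_le_scale` at scale `a = L^{−j}`, fine spacing
`b = L^{−(j+1)}`, for `Nc` coarse and `Nf` fine plaquettes counted in units of the level-`j` lattices
(`Nc·L^{−4j}, Nf·L^{−4(j+1)} ≤ n₀·vol·μ`): the level-`j` share of the (L) error is `≤ vol·n₀·C_L(ε₁)·μ·(L^{−2})^j`,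
`C_L = c₁c₃ε₁³ + c₃²ε₁⁴/2 + q·c₁⁴ε₁⁴` (generation 10's constant). [folklore] -/
theorem levelShareL_le {q L n₀ vol c₁ c₃ ε₁ sz ρb Nf Nc μ : ℝ} (hq : 0 ≤ q) (hL : 1 < L) (hn₀ : 0 ≤ n₀)
    (hvol : 0 ≤ vol) (hc₁ : 0 ≤ c₁) (hc₃ : 0 ≤ c₃) (hε₁ : 0 ≤ ε₁) (hμ : 0 ≤ μ) (j : ℕ)
    (hsz : 0 ≤ sz ∧ sz ≤ c₁ * ε₁ * ((L ^ (j + 1))⁻¹) ^ 2)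
    (hρb : 0 ≤ ρb ∧ ρb ≤ c₃ * ε₁ ^ 2 * ((L ^ j)⁻¹) ^ 4) (hNf0 : 0 ≤ Nf)
    (hNf : Nf * ((L ^ (j + 1))⁻¹) ^ 4 ≤ n₀ * (vol * μ)) (hNc0 : 0 ≤ Nc)
    (hNc : Nc * ((L ^ j)⁻¹) ^ 4 ≤ n₀ * (vol * μ)) :
    Nc * (L ^ 2 * sz * ρb + ρb ^ 2 / 2) + q * (Nf * sz ^ 4)
      ≤ vol * (n₀ * (c₁ * c₃ * ε₁ ^ 3 + c₃ ^ 2 * ε₁ ^ 4 / 2 + q * (c₁ ^ 4 * ε₁ ^ 4))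
          * (μ * ((L ^ 2)⁻¹) ^ j)) := by
  obtain ⟨ha0, ha1, hb0, hba, hrb, hξ⟩ := scale_facts hL j
  have h := averagingSize_le_scale (q := q) (r := L ^ 2) (n₀ := n₀) (vol := vol * μ) hq (by positivity) hn₀
    (mul_nonneg hvol hμ) hc₁ hc₃ hε₁ ha0 ha1 hb0 hba hrb hsz.1 hsz.2 hρb.1 hρb.2 hNf0 hNf hNc0 hNc
  rw [← hξ]
  calc Nc * (L ^ 2 * sz * ρb + ρb ^ 2 / 2) + q * (Nf * sz ^ 4)
      ≤ vol * μ * (n₀ * (c₁ * c₃ * ε₁ ^ 3 + c₃ ^ 2 * ε₁ ^ 4 / 2 + q * (c₁ ^ 4 * ε₁ ^ 4)) * ((L ^ j)⁻¹) ^ 2) := h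
    _ = vol * (n₀ * (c₁ * c₃ * ε₁ ^ 3 + c₃ ^ 2 * ε₁ ^ 4 / 2 + q * (c₁ ^ 4 * ε₁ ^ 4))
          * (μ * ((L ^ j)⁻¹) ^ 2)) := by ring

/-- **THE HETEROGENEOUS (L) BOUND AT ONE CUTOFF.**  One classical step (row sums `L²`, column sums `L⁻²`, `1 < L`)
from fine plaquettes `P` to windows `P′`, BOTH graded by levels `≤ K` (`lvl` on windows, `lvlf` on fine plaquettes);
on the window of a level-`j` window the fine field has size `≤ sz_j` and the BCH remainder is `≤ ρb_j`, a level-`j`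
fine plaquette carries a field of size `≤ sz_j`, with generation 10's size laws AT SCALE `L^{−j}`
(`sz_j ≤ c₁ε₁L^{−2(j+1)}`, `ρb_j ≤ c₃ε₁²L^{−4j}`); at most `Nc_j` windows and `Nf_j` fine plaquettes have level `j`, with
`Nc_j·L^{−4j}, Nf_j·L^{−4(j+1)} ≤ n₀·vol·μ_j`.  Then
`Σ_y e(ψ y) − Σ_x e(φ x) ≤ vol·n₀·C_L(ε₁)·Σ_{j ≤ K} μ_j·(L^{−2})^j` — the (L) companion of
`TermwiseHeterogeneous.interpolationError_le_levels`. [folklore] -/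
theorem averagingError_le_levels (P : Finset X) (P' : Finset Y) {w : Y → X → ℝ} {Φ : Y → X → V}
    {φ : X → V} {ψ : Y → V} {e : V → ℝ} {q L n₀ vol c₁ c₃ ε₁ : ℝ} (lvl : Y → ℕ) (lvlf : X → ℕ) (K : ℕ)
    {sz ρb Nc Nf μ : ℕ → ℝ}
    (he : ∀ v, ‖v‖ ^ 2 / 2 - q * ‖v‖ ^ 4 ≤ e v ∧ e v ≤ ‖v‖ ^ 2 / 2) (hq : 0 ≤ q) (hL : 1 < L)
    (hw : ∀ y ∈ P', ∀ x ∈ P, 0 ≤ w y x) (hrow : ∀ y ∈ P', ∑ x ∈ P, w y x = L ^ 2)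
    (hcol : ∀ x ∈ P, ∑ y ∈ P', w y x = (L ^ 2)⁻¹) (hΦ : ∀ y ∈ P', ∀ x ∈ P, ‖Φ y x‖ = ‖φ x‖)
    (hlvl : ∀ y ∈ P', lvl y ≤ K) (hlvlf : ∀ x ∈ P, lvlf x ≤ K)
    (hszw : ∀ y ∈ P', ∀ x ∈ P, 0 < w y x → ‖φ x‖ ≤ sz (lvl y))
    (hszf : ∀ x ∈ P, ‖φ x‖ ≤ sz (lvlf x))
    (hρw : ∀ y ∈ P', ‖ψ y - ∑ x ∈ P, w y x • Φ y x‖ ≤ ρb (lvl y))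
    (hn₀ : 0 ≤ n₀) (hvol : 0 ≤ vol) (hc₁ : 0 ≤ c₁) (hc₃ : 0 ≤ c₃) (hε₁ : 0 ≤ ε₁)
    (hsz : ∀ j, 0 ≤ sz j ∧ sz j ≤ c₁ * ε₁ * ((L ^ (j + 1))⁻¹) ^ 2)
    (hρb : ∀ j, 0 ≤ ρb j ∧ ρb j ≤ c₃ * ε₁ ^ 2 * ((L ^ j)⁻¹) ^ 4)
    (hμ : ∀ j, 0 ≤ μ j) (hNc0 : ∀ j, 0 ≤ Nc j) (hNf0 : ∀ j, 0 ≤ Nf j)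
    (hNcc : ∀ j ≤ K, ((P'.filter (fun y => lvl y = j)).card : ℝ) ≤ Nc j)
    (hNfc : ∀ j ≤ K, ((P.filter (fun x => lvlf x = j)).card : ℝ) ≤ Nf j)
    (hNc : ∀ j ≤ K, Nc j * ((L ^ j)⁻¹) ^ 4 ≤ n₀ * (vol * μ j))
    (hNf : ∀ j ≤ K, Nf j * ((L ^ (j + 1))⁻¹) ^ 4 ≤ n₀ * (vol * μ j)) :
    ∑ y ∈ P', e (ψ y) - ∑ x ∈ P, e (φ x)
      ≤ vol * (n₀ * (c₁ * c₃ * ε₁ ^ 3 + c₃ ^ 2 * ε₁ ^ 4 / 2 + q * (c₁ ^ 4 * ε₁ ^ 4))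
          * ∑ j ∈ Finset.range (K + 1), μ j * ((L ^ 2)⁻¹) ^ j) := by
  have hL0 : 0 < L := by linarith
  have hL2 : (0 : ℝ) ≤ L ^ 2 := by positivity
  have hrc : L ^ 2 * (L ^ 2)⁻¹ ≤ 1 := by rw [mul_inv_cancel₀ (pow_ne_zero 2 hL0.ne')]
  -- §1 with the level profiles
  have h1 := averagingError_le_of_profiles P P' (sz := fun y => sz (lvl y)) (ρ := fun y => ρb (lvl y))
    he hw hL2 hrow (fun x hx => (hcol x hx).le) hrc hΦ hszw (fun y _ => (hρb _).1) hρw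
  -- §2 grading of the window sum, G j = the level-j window share
  have hG : ∀ j, 0 ≤ L ^ 2 * sz j * ρb j + ρb j ^ 2 / 2 := fun j => by
    have := (hsz j).1; have := (hρb j).1; positivity
  have h2 := sum_le_sum_levels P' lvl K hlvl hG
    (F := fun y => L ^ 2 * sz (lvl y) * ρb (lvl y) + ρb (lvl y) ^ 2 / 2) (fun y _ => le_rfl) hNcc
  -- §2 grading of the fine quartic sum
  have hG' : ∀ j, 0 ≤ sz j ^ 4 := fun j => pow_nonneg (hsz j).1 4
  have h3 := sum_le_sum_levels P lvlf K hlvlf hG' (F := fun x => ‖φ x‖ ^ 4)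
    (fun x hx => pow_le_pow_left₀ (norm_nonneg _) (hszf x hx) 4) hNfc
  -- per level, generation 10's scaling at scale L^{-j}
  have h4 : ∑ j ∈ Finset.range (K + 1), Nc j * (L ^ 2 * sz j * ρb j + ρb j ^ 2 / 2)
        + q * ∑ j ∈ Finset.range (K + 1), Nf j * sz j ^ 4
      ≤ ∑ j ∈ Finset.range (K + 1), vol * (n₀ * (c₁ * c₃ * ε₁ ^ 3 + c₃ ^ 2 * ε₁ ^ 4 / 2 + q * (c₁ ^ 4 * ε₁ ^ 4))
          * (μ j * ((L ^ 2)⁻¹) ^ j)) := by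
    rw [Finset.mul_sum, ← Finset.sum_add_distrib]
    exact Finset.sum_le_sum fun j hj =>
      levelShareL_le hq hL hn₀ hvol hc₁ hc₃ hε₁ (hμ j) j (hsz j) (hρb j) (hNf0 j)
        (hNf j (Nat.le_of_lt_succ (Finset.mem_range.mp hj))) (hNc0 j)
        (hNc j (Nat.le_of_lt_succ (Finset.mem_range.mp hj)))
  rw [Finset.mul_sum, Finset.mul_sum]
  calc ∑ y ∈ P', e (ψ y) - ∑ x ∈ P, e (φ x)
      ≤ ∑ y ∈ P', (L ^ 2 * sz (lvl y) * ρb (lvl y) + ρb (lvl y) ^ 2 / 2) + q * ∑ x ∈ P, ‖φ x‖ ^ 4 := h1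
    _ ≤ ∑ j ∈ Finset.range (K + 1), Nc j * (L ^ 2 * sz j * ρb j + ρb j ^ 2 / 2)
          + q * ∑ j ∈ Finset.range (K + 1), Nf j * sz j ^ 4 := add_le_add h2 (mul_le_mul_of_nonneg_left h3 hq)
    _ ≤ _ := h4

end HeterogeneousL

/-! ## §8 From the window clause (Q-Bad) to level shares `≤ Λ^{K−j}` PER TERM -/

section WindowClause

variable {Y : Type*}

/-- Under the window clause `RecentOnly P′ lvl j₀ K` no window has a level below the cut. [folklore] -/
theorem card_filter_level_eq_zero (P' : Finset Y) (lvl : Y → ℕ) {j₀ K j : ℕ} (hrec : RecentOnly P' lvl j₀ K)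
    (hj : j < j₀) : (P'.filter (fun y => lvl y = j)).card = 0 := by
  rw [Finset.card_eq_zero, Finset.filter_eq_empty_iff]
  intro y hy h
  have := (hrec y hy).1
  omega

/-- Arithmetic of the two spacings: `(L^{K+s})⁴·(L^{−(j+s)})⁴ = (L⁴)^{K−j}` for `j ≤ K`, `L ≠ 0`. [folklore] -/
theorem pow_four_mul_inv_pow_four {L : ℝ} (hL : L ≠ 0) {j K : ℕ} (hj : j ≤ K) (s : ℕ) :
    (L ^ (K + s)) ^ 4 * ((L ^ (j + s))⁻¹) ^ 4 = (L ^ 4) ^ (K - j) := by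
  have hKs : K + s = (K - j) + (j + s) := by omega
  have hne : (L ^ (j + s)) ^ 4 ≠ 0 := pow_ne_zero _ (pow_ne_zero _ hL)
  rw [hKs, pow_add, mul_pow, inv_pow, mul_assoc, mul_inv_cancel₀ hne, mul_one, ← pow_mul, ← pow_mul, mul_comm]

/-- **LEVEL SHARES FROM THE COUNTS ALONE (windows).**  Under the window clause with the logarithmic cut and the coarse
count `#P′ ≤ n₀·vol·L^{4K}`, the number of level-`j` windows in units of the level-`j` lattice is
`≤ n₀·vol·Λ^{K−j}` on the window (`Λ = L⁴`; a volume FRACTION is `≤ 1` — no density statement) and `0` below the cut.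
[folklore] -/
theorem levelCount_coarse_le (P' : Finset Y) (lvl : Y → ℕ) {L n₀ vol Cl : ℝ} (hL : 1 < L) {K j : ℕ}
    (hj : j ≤ K) (hrec : RecentOnly P' lvl (jlogOf Cl K) K)
    (hcard : (P'.card : ℝ) ≤ n₀ * vol * (L ^ K) ^ 4) :
    ((P'.filter (fun y => lvl y = j)).card : ℝ) * ((L ^ j)⁻¹) ^ 4
      ≤ n₀ * (vol * (if jlogOf Cl K ≤ j then (L ^ 4) ^ (K - j) else 0)) := by
  have hL0 : 0 < L := by linarith
  by_cases hwin : jlogOf Cl K ≤ j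
  · rw [if_pos hwin]
    have hx : 0 ≤ ((L ^ j)⁻¹) ^ 4 := by positivity
    have e := pow_four_mul_inv_pow_four hL0.ne' hj 0
    simp only [Nat.add_zero] at e
    calc ((P'.filter (fun y => lvl y = j)).card : ℝ) * ((L ^ j)⁻¹) ^ 4 ≤ (P'.card : ℝ) * ((L ^ j)⁻¹) ^ 4 :=
          mul_le_mul_of_nonneg_right (Nat.cast_le.mpr (Finset.card_filter_le _ _)) hx
      _ ≤ n₀ * vol * (L ^ K) ^ 4 * ((L ^ j)⁻¹) ^ 4 := mul_le_mul_of_nonneg_right hcard hx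
      _ = n₀ * (vol * ((L ^ K) ^ 4 * ((L ^ j)⁻¹) ^ 4)) := by ring
      _ = n₀ * (vol * (L ^ 4) ^ (K - j)) := by rw [e]
  · rw [if_neg hwin, card_filter_level_eq_zero P' lvl hrec (not_le.mp hwin)]
    simp

/-- **LEVEL SHARES FROM THE COUNTS ALONE (fine plaquettes).**  As `levelCount_coarse_le` for the fine lattice:
`#P ≤ n₀·vol·L^{4(K+1)}` and the level-`j` unit `L^{−4(j+1)}`. [folklore] -/
theorem levelCount_fine_le (P : Finset Y) (lvlf : Y → ℕ) {L n₀ vol Cl : ℝ} (hL : 1 < L) {K j : ℕ}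
    (hj : j ≤ K) (hrec : RecentOnly P lvlf (jlogOf Cl K) K)
    (hcard : (P.card : ℝ) ≤ n₀ * vol * (L ^ (K + 1)) ^ 4) :
    ((P.filter (fun x => lvlf x = j)).card : ℝ) * ((L ^ (j + 1))⁻¹) ^ 4
      ≤ n₀ * (vol * (if jlogOf Cl K ≤ j then (L ^ 4) ^ (K - j) else 0)) := by
  have hL0 : 0 < L := by linarith
  by_cases hwin : jlogOf Cl K ≤ j
  · rw [if_pos hwin]
    have hx : 0 ≤ ((L ^ (j + 1))⁻¹) ^ 4 := by positivity
    have e := pow_four_mul_inv_pow_four hL0.ne' hj 1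
    calc ((P.filter (fun x => lvlf x = j)).card : ℝ) * ((L ^ (j + 1))⁻¹) ^ 4
        ≤ (P.card : ℝ) * ((L ^ (j + 1))⁻¹) ^ 4 :=
          mul_le_mul_of_nonneg_right (Nat.cast_le.mpr (Finset.card_filter_le _ _)) hx
      _ ≤ n₀ * vol * (L ^ (K + 1)) ^ 4 * ((L ^ (j + 1))⁻¹) ^ 4 := mul_le_mul_of_nonneg_right hcard hx
      _ = n₀ * (vol * ((L ^ (K + 1)) ^ 4 * ((L ^ (j + 1))⁻¹) ^ 4)) := by ring
      _ = n₀ * (vol * (L ^ 4) ^ (K - j)) := by rw [e]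
  · rw [if_neg hwin, card_filter_level_eq_zero P lvlf hrec (not_le.mp hwin)]
    simp

/-- The level sum of the count shares IS the tree's window sum (as an inequality, `F = 1`):
`Σ_{j ≤ K} [j⋆ ≤ j]·Λ^{K−j}·θ^j ≤ windowSum θ Λ j⋆ K` for `0 ≤ θ`. [folklore] -/
theorem sum_shares_le_windowSum {θ Λ : ℝ} (hθ : 0 ≤ θ) (j₀ K : ℕ) :
    ∑ j ∈ Finset.range (K + 1), (if j₀ ≤ j then Λ ^ (K - j) else 0) * θ ^ j ≤ windowSum θ Λ j₀ K := by
  have h := sum_range_le_windowSum (μ := fun j => if j₀ ≤ j then Λ ^ (K - j) else 0) (F := 1) (Λ := Λ) hθ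
    (j₀ := j₀) (K := K) (fun j hj => by rw [if_neg (not_le.mpr hj)]) (fun j hj _ => by rw [if_pos hj, one_mul])
  simpa using h

/-- The rate facts of the classical step: `θ = L⁻²` lies in `(0,1)` and `Λ = L⁴ ≥ 1`, for `1 < L`. [folklore] -/
theorem rate_facts {L : ℝ} (hL : 1 < L) : 0 < (L ^ 2)⁻¹ ∧ (L ^ 2)⁻¹ < 1 ∧ (1 : ℝ) ≤ L ^ 4 := by
  have hL0 : 0 < L := by linarith
  exact ⟨by positivity, inv_lt_one_of_one_lt₀ (by nlinarith), one_le_pow₀ hL.le⟩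

end WindowClause



/-! ## §9 Remarks: the King-type (all-top-level) history satisfies the window clause; the windowed majorant is
`poly(K)·(L⁻²)^K`; two numerical instances -/

section Remarks

/-- The ALL-TOP-LEVEL level map (every window regular at the cutoff's own level `K` — the King-type / all-small-field
history of generations 10–16) satisfies the window clause, whatever the cut constant. [folklore] -/
theorem recentOnly_top {Y : Type*} (P' : Finset Y) (Cl : ℝ) (K : ℕ) :
    RecentOnly P' (fun _ => K) (jlogOf Cl K) K :=
  fun _ _ => ⟨jlogOf_le Cl K, le_rfl⟩

/-- **THE WINDOWED MAJORANT IS `poly(K)·(L⁻²)^K`** (the tree's `T4MatchingClosure.windowSum_log_le`, displayed for the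
classical step's rate `θ = L⁻²`, `Λ = L⁴`): for `1 < L`, `0 ≤ Cl`, `0 ≤ C₀`,
`C₀·windowSum L⁻² L⁴ (jlogOf Cl K) K ≤ C₀·(Cl+2)·L⁶·(K+1)^{⌈Cl log L² + Cl log L⁴⌉+1}·(L⁻²)^K`. [folklore] -/
theorem windowedMajorant_le_poly {L Cl C₀ : ℝ} (hL : 1 < L) (hCl : 0 ≤ Cl) (hC₀ : 0 ≤ C₀) (K : ℕ) :
    C₀ * windowSum ((L ^ 2)⁻¹) (L ^ 4) (jlogOf Cl K) K
      ≤ C₀ * ((Cl + 2) * (L ^ 2 * L ^ 4) *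
          (((K : ℝ) + 1) ^ (⌈Cl * Real.log (L ^ 2) + Cl * Real.log (L ^ 4)⌉₊ + 1) * ((L ^ 2)⁻¹) ^ K)) := by
  obtain ⟨hθ0, hθ1, hΛ1⟩ := rate_facts hL
  have h := T4MatchingClosure.windowSum_log_le hθ0 hθ1 hΛ1 hCl K
  rw [inv_inv] at h
  exact mul_le_mul_of_nonneg_left h hC₀

/-- Two levels (`K = 1`, `L = 2`: `θ = 1/4`, `Λ = 16`) with the cut at the top (`j⋆ = 1`): the windowed majorant is the
top-level share `1/4` alone — generation 10's geometric factor. [folklore] -/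
example : windowSum (1 / 4 : ℝ) 16 1 1 = 1 / 4 := by
  simp [windowSum]

/-- The same two levels with the window opened to age 1 (`j⋆ = 0`): the age-1 rough share enters UNDISCOUNTED,
`16 + 1/4` — which is why the cut (the window clause) is load-bearing. [folklore] -/
example : windowSum (1 / 4 : ℝ) 16 0 1 = 16 + 1 / 4 := by
  rw [windowSum, show Finset.Icc 0 1 = {0, 1} by rfl]
  norm_num

end Remarks

end Summit.QuantumFields.BalabanUV.T4Continuum.TermwiseLevels
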